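import Literature.Barriers.HubbardSuperconductivity.SignProblemNPHardProofs
import Literature.Barriers.HubbardSuperconductivity.SignProblemNPHardIsingReduction
import Literature.Barriers.HubbardSuperconductivity.SignProblemNPHardIsingNP
import Literature.Computability.Complexity.ReductionsProofs
import HarnessLib

/-!
# `ISINGGROUND` is `NP`-complete: discharge of `isingGround_isNPComplete` (Barahona 1982)

Sibling proof file of `SignProblemNPHard.lean` (D-0014: the named fact
`Literature.Barriers.HubbardSuperconductivity.isingGround_isNPComplete : Prop := IsNPComplete ISINGGROUND`
stays a `def` there and is discharged here as `isingGround_isNPComplete_holds`).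

The printed source. F. Barahona, *On the computational complexity of Ising spin glass models*,
J. Phys. A 15 (1982) 3241–3253, §4.2 (held, `lit read paper:doi-10-1088-0305-4470-15-10-028`,
PDF pp. 16–20): "P3: Two-level spin glass. Given a two-level grid `G = (V, E)`, and a weighting
function `J : E → {-1, 0, 1}`, find the minimum of `H = -Σ J_{ij} S_i S_j` with `S_i ∈ {-1, 1}` …
Theorem. P3 is NP-hard" (p. 19), proved by reducing Yannakakis' maximum cocycle in cubic graphs
(P1) through minimum-weight cocycles in two-level grids (P2, Lemmas 1–2) and the identity
`-Σ J_{ij} S_i S_j = 2W - Σ J_{ij}` between cocycles of weight `W` and spin assignments; "the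
problem of finding a ground state in a three-dimensional spin glass is NP-hard, even in a two-level
grid and with interactions restricted to be `{-1, 0, 1}`" (p. 20). Troyer–Wiese use the decision
version, "to determine whether a state with energy less than or equal to a bound `E₀` exists", as
their `NP`-complete problem [cite: TroyerWiese2005, Letter p. 4]; the tree states it for coupling
MATRICES with entries in `{0, ±1}` (arbitrary interaction graphs) as `IsNPComplete ISINGGROUND`.

The Lean proof (both conjuncts at the machine level, Mathlib's `TM2` through the tree's `FP` algebra):

* **Membership** `ISINGGROUND ∈ NP` is `isingGround_mem_NP` (`SignProblemNPHardIsingNP.lean`: a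
  polynomial-time test recognising the codes of unit-coupling instances, and a polynomial-time
  verifier evaluating `E_J(σ_y) ≤ K` on a guessed configuration; `NP = ∃·P`).
* **Hardness.** The tree's proved source of `NP`-hardness is the Cook–Levin theorem
  (`SAT_isNPHard_holds`), carried by the clause-chain gadget of `SignProblemNPHardGadget.lean` to the
  language `SatIsing` of strings whose tokenised Ising instance has a configuration of energy
  `≤ -N(z)` (`satIsing_isNPHard`, `SignProblemNPHardProofs.lean`). The polynomial-time map
  `isingRedFn z = code (⟨n, J(toks z)⟩, -N(z))` (`SignProblemNPHardIsingReduction.lean`) is a Karp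
  reduction `SatIsing ≤ₚ ISINGGROUND` (`satIsing_karpReducible_isingGround`: `J(toks z)` has unit
  couplings, and a codeword lies in the image language iff its instance lies in `isingGroundSet`),
  so `ISINGGROUND` is `NP`-hard (`isingGround_isNPHard`, hardness propagating along `≤ₚ`,
  `IsHard.of_reducible_holds`). This replaces Barahona's planar route P1 → P2 → P3, which is not
  needed for matrix-coded instances; the statement proved is exactly the named fact.
* **Assembly** `isingGround_isNPComplete_holds`. (With `signProblem_decides_isingGround_holds` and
  `SignProblemNPHard.of_isingGround_isNPComplete` of `SignProblemNPHardIsingGround.lean` this also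
  yields the barrier along Troyer–Wiese's own route `NP ∋ L ≤ₚ ISINGGROUND ∈ P^O` with no remaining
  hypothesis; the barrier itself was already discharged through `SatIsing` as `SignProblemNPHard_holds`.)

## References

* F. Barahona, J. Phys. A 15 (1982) 3241–3253, §4.2, Theorem "P3 is NP-hard" (p. 19) and p. 20.
* M. Troyer, U.-J. Wiese, PRL 94 (2005) 170201, Letter p. 4.
* S. A. Cook, Proc. 3rd STOC (1971), Thm. 1; S. Arora, B. Barak, *Computational Complexity: A
  Modern Approach*, CUP 2009, Def. 2.7 and Thm. 2.8 (Karp reductions, hardness propagates),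
  Lemma 2.11 (Cook–Levin).
-/

noncomputable section

namespace Literature.Barriers.HubbardSuperconductivity

open _root_.Computability Literature.Computability.Complexity Literature.Computability.Complexity.Nondeterministic CNFIsing

/-- **`SatIsing ≤ₚ ISINGGROUND`**: the polynomial-time map `z ↦ code (⟨n, J(toks z)⟩, -N(z))`
(`isingRedFn`, `SignProblemNPHardIsingReduction.lean`) lands in `ISINGGROUND` iff `z ∈ SatIsing`,
because `J(toks z)` has unit couplings (`isUnitCoupling_J`) and a codeword is in the image language
iff its instance is in `isingGroundSet` (`Encoding.mem_toLanguage_iff`).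
[cite: Barahona1982, §4.2, Theorem (P3 is NP-hard), p. 19] [cite: AroraBarakCC2009, Def. 2.7] -/
theorem satIsing_karpReducible_isingGround : PolyTimeKarpReducible SatIsing ISINGGROUND := by
  refine ⟨isingRedFn, isingRedFn_mem_FP, fun z => ?_⟩
  rw [isingRedFn_apply]
  refine (mem_SatIsing_iff z).trans ?_
  change _ ↔ instEnc.encode _ ∈ instEnc.toLanguage isingGroundSet
  rw [Encoding.mem_toLanguage_iff, mem_isingGroundSet_iff]
  exact ⟨fun h => ⟨isUnitCoupling_J _, h⟩, fun h => h.2⟩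

/-- **`ISINGGROUND` is `NP`-hard**: `NP ∋ L ≤ₚ SatIsing ≤ₚ ISINGGROUND` (Cook–Levin through the
clause-chain gadget, `satIsing_isNPHard`, then the coding map; hardness propagates along Karp
reductions, `IsHard.of_reducible_holds`). [cite: Barahona1982, §4.2, Theorem (P3 is NP-hard), p. 19]
[cite: TroyerWiese2005, Letter p. 4] -/
theorem isingGround_isNPHard : IsNPHard ISINGGROUND :=
  IsHard.of_reducible_holds satIsing_isNPHard satIsing_karpReducible_isingGround

/-- **Barahona 1982 (in Troyer–Wiese's decision form) — DISCHARGED: the Ising ground-state problem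
with couplings `J_{jk} ∈ {0, ±J}` is `NP`-complete** (`isingGround_isNPComplete` holds for the tree's
matrix-coded language `ISINGGROUND`): membership by guessing the configuration and evaluating the
energy (`isingGround_mem_NP`, `SignProblemNPHardIsingNP.lean`), hardness by `isingGround_isNPHard`.
The printed theorem is NP-hardness already on two-level grids ("Theorem. P3 is NP-hard"; "even in a
two-level grid and with interactions restricted to be `{-1, 0, 1}`"); the Lean proof reaches the
arbitrary-graph language through the Cook–Levin theorem and the tree's clause-chain gadget instead of
Barahona's grid embedding. [cite: Barahona1982, §4.2, Theorem (P3 is NP-hard), p. 19 and p. 20]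
[cite: TroyerWiese2005, Letter p. 4] -/
theorem isingGround_isNPComplete_holds : isingGround_isNPComplete :=
  ⟨isingGround_mem_NP, isingGround_isNPHard⟩

end Literature.Barriers.HubbardSuperconductivity

end
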